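import Summits.BirchSwinnertonDyer.BirchSwinnertonDyer.Theorems.SignedLowerHalvesSmallImageLowerHalfBothSignsRttJunctionShaIotaDeep
import Summits.BirchSwinnertonDyer.BirchSwinnertonDyer.Theorems.SignedLowerHalvesSmallImageLowerHalfBothSignsRttJunctionShaIotaKernel
import Summits.BirchSwinnertonDyer.BirchSwinnertonDyer.Theorems.SignedLowerHalvesSmallImageLowerHalfBothSignsRttD2SeqJ3HS2
import Summits.BirchSwinnertonDyer.BirchSwinnertonDyer.Theorems.EisensteinPrimesPoitouTateShaNaturalAtTC
import Summits.BirchSwinnertonDyer.BirchSwinnertonDyer.Theorems.SignedLowerHalvesSmallImageLowerHalfBothSignsRttCharRoadE1ThetaSideFacts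
import Summits.BirchSwinnertonDyer.BirchSwinnertonDyer.Theorems.SignedLowerHalvesSmallImageLowerHalfBothSignsRttD2SeqJ3HS2Plumb
import HarnessLib

/-!
# Route `SignedLowerHalves`, crux L `SmallImageLowerHalfBothSigns` (stmt-BirchSwinnertonDyer-23599), line `rtt_w3` v35 — stub S3α″ (`stub_junctionShaPi_ns`),
# brick α5′-6: ★★★ THE POITOU–TATE MAP `π` FOR `A = Cofree θ F` — CLOSING FORM: a `Λ`-linear `π : Hom(Sel_{str at Σ}(K_∞, A), ℚ/ℤ) → 𝐇²_{Iw,P}` (lambda-p1's `strictDualModule`,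
# honda's `I.moduleIwasawa`) whose range contains every class all of whose level projections lie in `Ш²_P(K_n, X_k)`

INPUTS hand `bsd-inputs-honda-p1` g29 under LEAD `cruxlead-stmt-BirchSwinnertonDyer-23599` (cell `bsd-ssimc`); helper `--supports stmt-BirchSwinnertonDyer-23599`.
THEOREMS ONLY (no definition, no named fact, no instance, no `sorry`). Assembles the bricks α5′-1 … α5′-5 (`…RttJunctionShaPairing/LayerMaps/PairingNat/Rigidity/Socket/PiGlue/
Iota/IotaSelmer/IotaKernel/IotaDeep`) at `A := Cofree θ F`: the coefficient pairings `B k := cofreeLamPairing S K λ hλ θ k` of -w3 for a `λ : 𝒪 → ℤ_p` perfect modulo every `p^k`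
(`exists_lam_perfect`), equivariant for `θ′θ = 1` (`cofreeLamPairing_muTwistO_smul`), compatible with the levels (`muInclusion_cofreeLamPairing_oMuRed`), PERFECT
(`bijective_flip_cofreeLamPairing`, §1); the Poitou–Tate naturality `hPT` is the tree's theorem for totally complex `K`
(`PoitouTateShaNaturalAtTC.forall_poitouTate_shaRestricted_tateDual_natural_at_of_isTotallyComplex`).
* §1 ★ `bijective_flip_cofreeLamPairing` — `a ↦ ⟪·, a⟫ : A[p^k] ≅ Hom(𝒪 ⊗ μ_{p^k}, μ_{p^k})`; `iotaSelOf_kernel` (kernel property of the strict-Selmer-valued maps).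
* §2 ★★★ `exists_piLinear_of_cofree` — for `K` totally complex, `κ` CYCLOTOMIC with top generator `γK` (the layers `Γ_K ⧸ U_n` are finite: `Fintype.ofFinite`), `θ′θ = 1`, `P ⊇ {w ∣ p}` finite with `N_P ≤ U_n`, `θ′|_{N_P} = 1`,
  and honda's datum `I : CycIwasawaCohomologyDataO S κ γK⁻¹ θ′ P 2`: `∃ π : (strictSelmer κ A 𝒪 V j S₀ ε Σ →+ ℚ/ℤ) →ₗ[Λ] I.H` (structures `strictDualModule … hγK`,
  `I.moduleIwasawa`) with `(∀ n k, I.proj n k b ∈ Ш²_P(K_n, X_k)) → b ∈ range π` — the registered conclusion of S3α″ up to the LEAD's dictionary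
  `SmallImageRttJunctionSha.mem_layerShaRestricted_iff_forall_loc` (levelwise local vanishing ↔ layer-`Ш²`) and the frame's inputs (RECIPE in the docstring of §2).
HONEST FRAMING: this is the `π`-half (α5′) of row S3α; the stub S3α″ itself is closed only when the LEAD pastes the recipe; crux L, crux M and BSD are NOT proved here and
remain OPEN; BSD is proved for NO curve.
References: [JohnsonLeungKings2011] §5.4 Lemma 5.8; [MilneADT2006] I Thm. 4.10 (a); [NeukirchSchmidtWingberg2008] (7.2.6), (8.6.10); [Rubin2000] §4.2; [Kobayashi2003] Thm. 7.3 i);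
[PerrinRiou1994Invent] §1.3; [GreenbergLNM1716] §2 (p. 70).
-/

set_option autoImplicit false
set_option linter.dupNamespace false -- D-0017: single-problem summit, the namespace repeats the problem name by design
noncomputable section

open scoped Classical
open NumberField IsDedekindDomain Field Function CategoryTheory

namespace Summit.BirchSwinnertonDyer.BirchSwinnertonDyer.Theorems.SmallImageRttJunctionSha

open Literature.NumberTheory.EllipticCurves Literature.NumberTheory.EllipticCurves.GreenbergSelmer Literature.NumberTheory.EllipticCurves.IwasawaDual
  Literature.NumberTheory.GaloisRepresentations Literature.NumberTheory.GaloisRepresentations.DiscreteGaloisModule Literature.NumberTheory.GaloisCohomology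
  Literature.NumberTheory.GaloisCohomology.ShaLayer Literature.NumberTheory.ComplexMultiplication.EllipticUnits Literature.NumberTheory.ComplexMultiplication.EllipticUnits.JohnsonLeungKings2011
  Summit.BirchSwinnertonDyer.BirchSwinnertonDyer.Theorems.SmallImageRttD2J1 Summit.BirchSwinnertonDyer.BirchSwinnertonDyer.Theorems.SmallImageRttD2Seq

/-! ## §1 Perfectness of the coefficient pairings; the kernel property of `iotaSelOf` -/

section Coeff

variable {K : Type} [Field K] [NumberField K] {p : ℕ} [Fact p.Prime] (S : Set (PadicAlgCl p)) (lam : padicCoeffIntegers S →+ ℤ_[p])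
  (hlam : ∀ (c : ℤ_[p]) (y : padicCoeffIntegers S), lam (padicIntToCoeffIntegers S c * y) = c * lam y)
  (θ : FramedGaloisRep K (padicCoeffIntegers S) 1)

include hlam in
/-- ★ **PERFECTNESS of the `λ`-pairing on the right: `a ↦ ⟪·, a⟫ : A[p^k] → Hom(𝒪 ⊗ μ_{p^k}, μ_{p^k})` is BIJECTIVE** when `λ mod p^k` is non-degenerate (`hlamInj`) and onto
(`hlamSurj`) — the twin of -w3's `bijective_flip_cofreeLamCoeffPairingK` on the WHOLE carrier (no `N_P`-invariants): injectivity tested on `b ⊗ ζ₀`, surjectivity by reading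
`f` on `b ⊗ ζ₀` through `μ_{p^k} ≃ ℤ/p^k` (`ζ₀` a generator). [cite: Rubin2000, §4.2] [cite: NeukirchSchmidtWingberg2008, (7.2.6), I §5 Prop. 1.5.3] -/
theorem bijective_flip_cofreeLamPairing (k : ℕ)
    (hlamInj : ∀ t : padicCoeffIntegers S, (∀ b : padicCoeffIntegers S, lamZMod S lam k (b * t) = 0) → t ∈ Ideal.span {((p : ℕ) : padicCoeffIntegers S) ^ k})
    (hlamSurj : ∀ g : padicCoeffIntegers S →+ ZMod (p ^ k), ∃ t : padicCoeffIntegers S, ∀ b : padicCoeffIntegers S, g b = lamZMod S lam k (b * t)) :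
    Bijective fun a : ↥(torsionPow (Cofree θ (padicCoeffField S)) p k) ↦ (cofreeLamPairing S K lam hlam θ k).flip a := by
  haveI : NeZero (p ^ k) := ⟨pow_ne_zero _ (Fact.out : p.Prime).ne_zero⟩
  obtain ⟨e, ζ₀, -, hgen, hord⟩ := exists_generator_muCarrier K (p := p) k
  have hval : ∀ (b : padicCoeffIntegers S) (t : Fin 1 → padicCoeffIntegers S),
      cofreeLamPairing S K lam hlam θ k (OMuCarrier.tmul b ζ₀) (divPowTors S K θ k t) = zmodSMulMu K (p ^ k) ζ₀ (lamZMod S lam k (b * t 0)) := by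
    intro b t
    rw [cofreeLamPairing_divPowTors, lamPairing_tmul]
  have hsm : ∀ y : MuCarrier K (p ^ k), zmodSMulMu K (p ^ k) ζ₀ (e y) = y := by
    intro y
    conv_rhs => rw [hgen y]
    rw [← zmodSMulMu_intCast K (p ^ k) ζ₀ ((e y).val : ℤ), Int.cast_natCast, ZMod.natCast_zmod_val]
  have hsm0 : ∀ r : ZMod (p ^ k), zmodSMulMu K (p ^ k) ζ₀ r = 0 → r = 0 := by
    intro r hr
    obtain ⟨w, rfl⟩ := ZMod.intCast_surjective r
    rw [zmodSMulMu_intCast] at hr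
    exact (ZMod.intCast_zmod_eq_zero_iff_dvd w (p ^ k)).mpr ((hord w).mp hr)
  constructor
  · rw [show (fun a : ↥(torsionPow (Cofree θ (padicCoeffField S)) p k) ↦ (cofreeLamPairing S K lam hlam θ k).flip a) =
        ⇑(cofreeLamPairing S K lam hlam θ k).flip from rfl, injective_iff_map_eq_zero]
    intro a ha
    obtain ⟨t, rfl⟩ := exists_divPowTors_eq S K θ k a
    have hv : ∀ b : padicCoeffIntegers S, lamZMod S lam k (b * t 0) = 0 := by
      intro b
      have h1 := DFunLike.congr_fun ha (OMuCarrier.tmul b ζ₀)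
      rw [AddMonoidHom.flip_apply, AddMonoidHom.zero_apply, hval] at h1
      exact hsm0 _ h1
    apply Subtype.ext
    rw [coe_divPowTors_apply, ZeroMemClass.coe_zero, divPowCofreeMk_eq_zero_iff]
    intro i
    rw [Subsingleton.elim i 0]
    exact hlamInj (t 0) hv
  · intro f
    let g : padicCoeffIntegers S →+ ZMod (p ^ k) :=
      { toFun := fun b ↦ e (f (OMuCarrier.tmul b ζ₀))
        map_zero' := by rw [SmallImageRttD2Seq.zero_tmul_eq, map_zero, map_zero]
        map_add' := fun b c ↦ by rw [OMuCarrier.add_tmul S b c ζ₀, map_add, map_add] }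
    obtain ⟨t, ht⟩ := hlamSurj g
    refine ⟨divPowTors S K θ k (fun _ ↦ t), AddMonoidHom.ext fun x ↦ ?_⟩
    obtain ⟨b, rfl⟩ := exists_eq_tmul_of_generator K S k (fun ζ ↦ ⟨_, hgen ζ⟩) x
    rw [AddMonoidHom.flip_apply, hval, ← ht b]
    exact hsm _

end Coeff

section KernelSel

variable {K : Type} [Field K] [NumberField K] {p : ℕ} [Fact p.Prime] (κ : ZpExtension K p) (P : Set (HeightOneSpectrum (𝓞 K)))
  (M : Type) [AddCommGroup M] [DistribMulAction (absoluteGaloisGroup K) M] [TopologicalSpace M] [DiscreteTopology M]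
  (hstab : ∀ m : M, IsOpen (MulAction.stabilizer (absoluteGaloisGroup K) m : Set (absoluteGaloisGroup K)))
  (hNP : ∀ n : ℕ, ramificationSubgroup K P ≤ κ.layerSubgroup n) (hA : ∀ k : ℕ, ramificationSubgroup K P ≤ ContinuousRep.ker (torsRep M hstab p k))
  (R : Type*) [Ring R] [Module R M] (V : WeierstrassCurve K) (j : V.geomPrimaryTorsion p →+ M) (S₀ : Set (HeightOneSpectrum (𝓞 K))) (ε : ℤˣ)
  (S₁ : Set (HeightOneSpectrum (𝓞 K))) (hκ : κ.IsCyclotomic) (htor : ∀ m : M, ∃ k : ℕ, p ^ k • m = 0)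
  (hpP : ∀ v : HeightOneSpectrum (𝓞 K), ((p : ℕ) : 𝓞 K) ∈ v.asIdeal → v ∈ P)

/-- **The kernel property of `iotaSelOf`** (`iotaO_kernel` + `iotaSelOf_eq_zero_iff`). [cite: JohnsonLeungKings2011, §5.4 Lemma 5.8 (proof, arXiv p0015:L150–165)]
[cite: SerreGaloisCohomology1997, I §2.2 Prop. 8] -/
theorem iotaSelOf_kernel (n k : ℕ) (z : ↥(layerShaRestricted P (torsRep M hstab p k) (κ.layerSubgroup n) 1))
    (hz : iotaSelOf κ P M hstab R V j S₀ ε S₁ hκ htor hpP n k z = 0) :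
    ∃ b a : ℕ, resYOIter κ P M hstab hNP hA n (k + b) a (inclYOIter κ P M hstab hNP hA n k b z) = 0 :=
  iotaO_kernel κ P M hstab hNP hA htor n k z ((iotaSelOf_eq_zero_iff κ P M hstab R V j S₀ ε S₁ hκ htor hpP n k z).1 hz)

end KernelSel

/-! ## §2 The Poitou–Tate map for `A = Cofree θ F` -/

section Closing

variable {K : Type} [Field K] [NumberField K] [IsTotallyComplex K] {p : ℕ} [Fact p.Prime] (S : Set (PadicAlgCl p)) [FiniteDimensional ℚ_[p] (padicCoeffField S)]
  (κ : ZpExtension K p) (hκ : κ.IsCyclotomic) {γK : absoluteGaloisGroup K} (hγK : κ.IsTopGenerator γK)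
  (θ : FramedGaloisRep K (padicCoeffIntegers S) 1) (θ' : absoluteGaloisGroup K →ₜ* (padicCoeffIntegers S)ˣ)
  (hθ'θ : ∀ g : absoluteGaloisGroup K, ((θ' g : (padicCoeffIntegers S)ˣ) : padicCoeffIntegers S) *
    ((θ g : GL (Fin 1) (padicCoeffIntegers S)) : Matrix (Fin 1) (Fin 1) (padicCoeffIntegers S)) 0 0 = 1)
  (P : Set (HeightOneSpectrum (𝓞 K))) (hPfin : P.Finite) (hpP : ∀ v : HeightOneSpectrum (𝓞 K), ((p : ℕ) : 𝓞 K) ∈ v.asIdeal → v ∈ P)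
  (hNP : ∀ n : ℕ, ramificationSubgroup K P ≤ κ.layerSubgroup n) (hθN : ∀ g ∈ ramificationSubgroup K P, θ' g = 1)
  (V : WeierstrassCurve K) (j : V.geomPrimaryTorsion p →+ Cofree θ (padicCoeffField S)) (S₀ S₁ : Set (HeightOneSpectrum (𝓞 K))) (ε : ℤˣ)
  (I : CycIwasawaCohomologyDataO S κ γK⁻¹ θ' P 2)

include hκ hθ'θ hPfin hpP hNP hθN in
/-- ★★★ **THE POITOU–TATE MAP `π` FOR `A = Cofree θ F`** (the `π`-half α5′ of row S3α): for `K` totally complex, `κ` cyclotomic with top generator `γK`, `θ′θ = 1`, `P ⊇ {w ∣ p}` finite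
with `N_P ≤ U_n`, `θ′|_{N_P} = 1` (so `N_P` is trivial on `A`: `frame_apply_eq_one_of_eq_one` + `smul_cofree_eq_of_apply_eq_one`), and honda's pinned datum `I` at `(κ, γK⁻¹, θ′, P)`: there is a `Λ`-LINEAR `π : Hom(Sel_{str at Σ}(K_∞, A), ℚ/ℤ) → I.H` (domain with
lambda-p1's `strictDualModule … hγK`, codomain with `I.moduleIwasawa`) whose range contains every `b` with `I.proj n k b ∈ Ш²_P(K_n, X_k)` for all `n, k`.
RECIPE for S3α″ (stub binders): `κ := κ.restrictOfFinrankEqTwo hp K hK2` (`hκ` by `SmallImageRttD2Seq.isCyclotomic_restrictOfFinrankEqTwo`), `P := suppPF p 𝔣`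
(`hPfin := finite_suppPF_of_ne_bot (SmallImageRttCharRoadJ2.ne_bot_of_auxIdeals a)`, `hpP` from `mem_suppPF_of_eq_span 𝔣 hv` + `eq_of_natCast_mem_asIdeal_of_eq_span hv`, `hNP` from the
frame, `hθN := frame_eq_one_of_mem_ramificationSubgroup S hU`), `V := W.baseChange K`, `S₀ := S₀K`, `Σ := S₀K ∪ {w ∣ p}`,
`[FiniteDimensional] := Module.finite_of_finrank_pos hS`, `[IsTotallyComplex K] := htc`; then the stub's hypothesis on `b` is `∀ n k, I₂.proj n k b ∈ Ш²` by
`mem_layerShaRestricted_iff_forall_loc S κ θ′ (suppPF p 𝔣) hNP`. [cite: JohnsonLeungKings2011, §5.4 Lemma 5.8] [cite: MilneADT2006, I Thm. 4.10 (a)] [cite: NeukirchSchmidtWingberg2008, (8.6.10)]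
[cite: Kobayashi2003, Thm. 7.3 i)] [cite: PerrinRiou1994Invent, §1.3] -/
theorem exists_piLinear_of_cofree :
    letI := I.moduleIwasawa
    letI := strictDualModule κ (padicCoeffIntegers S) V j S₀ ε S₁ (exists_pow_smul_cofree_eq_zero S θ) (isOpen_stabilizer_cofree S θ) hγK
    ∃ π : (↥(strictSelmer κ (Cofree θ (padicCoeffField S)) (padicCoeffIntegers S) V j S₀ ε S₁) →+ AddCircle (1 : ℚ)) →ₗ[IwasawaAlgebra p] I.H,
      ∀ b : I.H, (∀ n k : ℕ, I.proj n k b ∈ layerShaRestricted P (muTwistO S θ' k) (κ.layerSubgroup n) 2) → b ∈ LinearMap.range π := by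
  haveI : ∀ n : ℕ, Fintype (absoluteGaloisGroup K ⧸ κ.layerSubgroup n) := fun n ↦ Fintype.ofFinite _
  have hlam₀ := exists_lam_perfect S
  obtain ⟨lam, hlam, hInj, hSurj⟩ := hlam₀
  have hstab := isOpen_stabilizer_cofree S θ
  have htor := exists_pow_smul_cofree_eq_zero S θ
  have hAP : ∀ τ ∈ ramificationSubgroup K P, ∀ m : Cofree θ (padicCoeffField S), τ • m = m := fun τ hτ m ↦
    SmallImageCharSignedSelmer.smul_cofree_eq_of_apply_eq_one θ (frame_apply_eq_one_of_eq_one S θ hθ'θ (hθN τ hτ)) m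
  have hA : ∀ k : ℕ, ramificationSubgroup K P ≤ ContinuousRep.ker (torsRep (Cofree θ (padicCoeffField S)) hstab p k) :=
    ramificationSubgroup_le_ker_torsRep P (Cofree θ (padicCoeffField S)) hstab hAP
  have hμ : ∀ k : ℕ, ramificationSubgroup K P ≤ ContinuousRep.ker (muTwistO S θ' k) :=
    ramificationSubgroup_le_ker_muTwistO S θ' P hθN fun w hw hpw ↦ hw (hpP w hpw)
  have hPT : poitouTate_shaRestricted_tateDual_natural_at K P :=
    PoitouTateShaNaturalAtTC.forall_poitouTate_shaRestricted_tateDual_natural_at_of_isTotallyComplex K P hPfin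
  have hB : ∀ (k : ℕ) (σ : absoluteGaloisGroup K) (x : OMuCarrier K S (p ^ k)) (m : ↥(torsionPow (Cofree θ (padicCoeffField S)) p k)),
      cofreeLamPairing S K lam hlam θ k (muTwistO S θ' k σ x) (torsRep (Cofree θ (padicCoeffField S)) hstab p k σ m) =
        mu K (p ^ k) σ (cofreeLamPairing S K lam hlam θ k x m) := fun k σ x m ↦
    cofreeLamPairing_muTwistO_smul S K lam hlam θ k θ' σ (hθ'θ σ) x m
  have hperf : ∀ k : ℕ, Function.Bijective fun m : ↥(torsionPow (Cofree θ (padicCoeffField S)) p k) ↦ (cofreeLamPairing S K lam hlam θ k).flip m :=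
    fun k ↦ bijective_flip_cofreeLamPairing S lam hlam θ k (hInj k) (hSurj k)
  have hBred : ∀ (k : ℕ) (x : OMuCarrier K S (p ^ (k + 1))) (m : ↥(torsionPow (Cofree θ (padicCoeffField S)) p k)),
      muVal K (p ^ k) (cofreeLamPairing S K lam hlam θ k (oMuRed S k x) m) =
        muVal K (p ^ (k + 1)) (cofreeLamPairing S K lam hlam θ (k + 1) x (AddSubgroup.inclusion (torsionPow_mono (M := Cofree θ (padicCoeffField S)) (p := p) (Nat.le_succ k)) m)) :=
    fun k x m ↦ congrArg (muVal K (p ^ (k + 1))) (muInclusion_cofreeLamPairing_oMuRed S K lam hlam θ k x m)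
  have hU := isLocNil_conjStrict_sub_one κ (padicCoeffIntegers S) V j S₀ ε S₁ htor hstab hγK
  have hιc : ∀ (n k : ℕ) (z : ↥(layerShaRestricted P (torsRep (Cofree θ (padicCoeffField S)) hstab p k) (κ.layerSubgroup n) 1)),
      iotaSelOf κ P (Cofree θ (padicCoeffField S)) hstab (padicCoeffIntegers S) V j S₀ ε S₁ hκ htor hpP n k
          (conjYO κ P (Cofree θ (padicCoeffField S)) hstab n k γK⁻¹⁻¹ z) =
        conjStrict κ (Cofree θ (padicCoeffField S)) (padicCoeffIntegers S) V j S₀ ε S₁ γK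
          (iotaSelOf κ P (Cofree θ (padicCoeffField S)) hstab (padicCoeffIntegers S) V j S₀ ε S₁ hκ htor hpP n k z) := fun n k z ↦ by
    simp only [inv_inv]
    exact iotaSelOf_conjYO κ P (Cofree θ (padicCoeffField S)) hstab (padicCoeffIntegers S) V j S₀ ε S₁ hκ htor hpP n k γK z
  refine ⟨piLinear S κ γK⁻¹ θ' P (Cofree θ (padicCoeffField S)) hstab (cofreeLamPairing S K lam hlam θ) hB hPT hNP hμ hA hpP hperf
      (↥(strictSelmer κ (Cofree θ (padicCoeffField S)) (padicCoeffIntegers S) V j S₀ ε S₁))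
      (iotaSelOf κ P (Cofree θ (padicCoeffField S)) hstab (padicCoeffIntegers S) V j S₀ ε S₁ hκ htor hpP)
      (iotaSelOf_resYO κ P (Cofree θ (padicCoeffField S)) hstab (padicCoeffIntegers S) V j S₀ ε S₁ hκ htor hpP hNP hA)
      (iotaSelOf_inclYO κ P (Cofree θ (padicCoeffField S)) hstab (padicCoeffIntegers S) V j S₀ ε S₁ hκ htor hpP hNP hA)
      hBred I (conjStrict κ (Cofree θ (padicCoeffField S)) (padicCoeffIntegers S) V j S₀ ε S₁ γK) hU hιc, fun b hb ↦ ?_⟩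
  exact (piLinear_mem_range_iff_of_kernelProperty S κ γK⁻¹ θ' P (Cofree θ (padicCoeffField S)) hstab (cofreeLamPairing S K lam hlam θ) hB hPT hNP hμ hA hpP hperf
    _ _ _ _ hBred I _ hU hιc
    (iotaSelOf_kernel κ P (Cofree θ (padicCoeffField S)) hstab hNP hA (padicCoeffIntegers S) V j S₀ ε S₁ hκ htor hpP) b).2 hb

include hκ hθ'θ hPfin hpP hNP hθN in
/-- ★★★ **THE SAME WITH THE STUB'S HYPOTHESIS ON `b`** (levelwise local vanishing in degree 2 at the places of `P`, all conjugates — the LEAD's dictionary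
`mem_layerShaRestricted_iff_forall_loc`): the conclusion of S3α″ `stub_junctionShaPi_ns` for `κ := κ.restrictOfFinrankEqTwo hp K hK2`, `P := suppPF p 𝔣`, `V := W.baseChange K`,
`S₀ := S₀K`, `Σ := S₀K ∪ {w ∣ p}`. [cite: JohnsonLeungKings2011, §5.4 Lemma 5.8] [cite: MilneADT2006, I Thm. 4.10 (a)] [cite: NeukirchSchmidtWingberg2008, (8.6.10)] -/
theorem exists_piLinear_of_cofree_loc :
    letI := I.moduleIwasawa
    letI := strictDualModule κ (padicCoeffIntegers S) V j S₀ ε S₁ (exists_pow_smul_cofree_eq_zero S θ) (isOpen_stabilizer_cofree S θ) hγK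
    ∃ π : (↥(strictSelmer κ (Cofree θ (padicCoeffField S)) (padicCoeffIntegers S) V j S₀ ε S₁) →+ AddCircle (1 : ℚ)) →ₗ[IwasawaAlgebra p] I.H,
      ∀ b : I.H, (∀ w ∈ P, ∀ (n k : ℕ) (δ : absoluteGaloisGroup K),
          ContinuousCohomology.map (locLayerHom κ P w n) (locLayerMod S κ θ' P w n k) 2 (cycLayerConjO S κ θ' P n k 2 δ (I.proj n k b)) = 0) →
        b ∈ LinearMap.range π := by
  have h := exists_piLinear_of_cofree S κ hκ hγK θ θ' hθ'θ P hPfin hpP hNP hθN V j S₀ S₁ ε I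
  obtain ⟨π, hπ⟩ := h
  exact ⟨π, fun b hb ↦ hπ b fun n k ↦ (mem_layerShaRestricted_iff_forall_loc S κ θ' P hNP n k _).mpr fun w hw δ ↦ hb w hw n k δ⟩

omit [FiniteDimensional ℚ_[p] (padicCoeffField S)] in
include hκ hθ'θ in
/-- ★★★ **S3α″ IN FRAME CURRENCY** (the paste for `stub_junctionShaPi_ns`): for `K` totally complex, `0 < [F:ℚ_p]`, `κ` cyclotomic with top generator `γK`, `θ′θ = 1`, a frame level `𝔣 ≠ 0` with
(U) «`θ′` unramified outside `supp(p𝔣)`» and `N_{supp p𝔣} ≤ U_n`, the inert `vp = (p)`, and honda's `I₂` at `(κ, γK⁻¹, θ′, supp p𝔣)`: the Poitou–Tate map `π` with the registered range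
property. RECIPE (stub binders): `exact exists_pi_of_frame S hS (κ.restrictOfFinrankEqTwo hp K hK2) (SmallImageRttD2Seq.isCyclotomic_restrictOfFinrankEqTwo hp κ K hK2 hκ) hγK θ θ' hframe.2.2.1 𝔣
(SmallImageRttCharRoadJ2.ne_bot_of_auxIdeals a) vp hv hNP hsupp.2 (W.baseChange K) j _ _ ε I₂` after `intro … hframe hsupp I₂` and `haveI := htc` (with `hNP` as in `SmallImageLowerHalfBothSigns_of`).
[cite: JohnsonLeungKings2011, §5.4 Lemma 5.8] [cite: MilneADT2006, I Thm. 4.10 (a)] [cite: NeukirchSchmidtWingberg2008, (8.6.10)] [cite: Kobayashi2003, Thm. 7.3 i)] [cite: PerrinRiou1994Invent, §1.3] -/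
theorem exists_pi_of_frame (hS : 0 < Module.finrank ℚ_[p] (padicCoeffField S)) (𝔣 : Ideal (𝓞 K)) (h𝔣 : 𝔣 ≠ ⊥)
    (vp : HeightOneSpectrum (𝓞 K)) (hv : vp.asIdeal = Ideal.span {((p : ℕ) : 𝓞 K)})
    (hNP𝔣 : ∀ n : ℕ, ramificationSubgroup K (suppPF p 𝔣) ≤ κ.layerSubgroup n)
    (hU : ∀ w : HeightOneSpectrum (𝓞 K), w ∉ suppPF p 𝔣 → ∀ 𝔓 ∈ w.primesAbove, ∀ τ ∈ 𝔓.inertia (absoluteGaloisGroup K), θ' τ = 1)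
    (V' : WeierstrassCurve K) (j' : V'.geomPrimaryTorsion p →+ Cofree θ (padicCoeffField S)) (S₀' S₁' : Set (HeightOneSpectrum (𝓞 K))) (ε' : ℤˣ)
    (I₂ : CycIwasawaCohomologyDataO S κ γK⁻¹ θ' (suppPF p 𝔣) 2) :
    letI := I₂.moduleIwasawa
    letI := strictDualModule κ (padicCoeffIntegers S) V' j' S₀' ε' S₁' (exists_pow_smul_cofree_eq_zero S θ) (isOpen_stabilizer_cofree S θ) hγK
    ∃ π : (↥(strictSelmer κ (Cofree θ (padicCoeffField S)) (padicCoeffIntegers S) V' j' S₀' ε' S₁') →+ AddCircle (1 : ℚ)) →ₗ[IwasawaAlgebra p] I₂.H,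
      ∀ b : I₂.H, (∀ w ∈ suppPF p 𝔣, ∀ (n k : ℕ) (δ : absoluteGaloisGroup K),
          ContinuousCohomology.map (locLayerHom κ (suppPF p 𝔣) w n) (locLayerMod S κ θ' (suppPF p 𝔣) w n k) 2
            (cycLayerConjO S κ θ' (suppPF p 𝔣) n k 2 δ (I₂.proj n k b)) = 0) →
        b ∈ LinearMap.range π := by
  haveI : FiniteDimensional ℚ_[p] (padicCoeffField S) := Module.finite_of_finrank_pos hS
  exact exists_piLinear_of_cofree_loc S κ hκ hγK θ θ' hθ'θ (suppPF p 𝔣) (finite_suppPF_of_ne_bot h𝔣)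
    (fun w hw ↦ (eq_of_natCast_mem_asIdeal_of_eq_span hv w hw) ▸ mem_suppPF_of_eq_span 𝔣 hv) hNP𝔣
    (frame_eq_one_of_mem_ramificationSubgroup S hU) V' j' S₀' S₁' ε' I₂

end Closing

end Summit.BirchSwinnertonDyer.BirchSwinnertonDyer.Theorems.SmallImageRttJunctionSha

end
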